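import Summits.CriticalPhenomena.PercolationContinuityZ3.Theorems.Transplant.SkelPhiEquilibriumWDefs
import Summits.CriticalPhenomena.PercolationContinuityZ3.Theorems.Transplant.SkelPhiEquilibriumLimits
import HarnessLib

/-!
# N2 (frames-only node, OPEN) — the LEVEL-0 statement shape of record `Skelφ.EquilibriumAtW2S` ("2S" = two-sided sides, Slid box), p3-g13's letter 2026-08-22 15:10:58Z
# (letter v1.3: fields `(o = (s, b), h, ℓs, m)`, clauses (a)(d)(f)); the N1-compatibility lemma `EquilibriumAtW.toW2S`; the conclusion sentence `Skelφ.BothSidesLinked2S` (OPEN, never asserted)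

builds on p205010 (kernel theorem, internal audit signed; external expert review pending) — nothing here uses p205010 and NOTHING is claimed: this file has
DEFINITIONS and one compatibility lemma. Lane `prim-bschramm`, seat `prim-hp-8` (gen 37); filed on the lead's word 2026-08-22 15:28:08Z (i) as the S3 line's LEVEL-0 statement.
* ONE offset twin of the parallelogram geometry taking a centre offset `o : Site 2` (the slid centre `φ t + o`, `o = (s, b)`): `relCoordO`, `shearCoordO`,
  `pgramCylO`, `pgScaleO`, `pgramPrismO`, and the side-half family `pgSideHalfS` filtered from the TALL region (height parameter `L`, = `3ℓs` in the statement)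
  at its own height `ℓs`, split at an independent β′-offset `m` per side (parity, p5-g13 15:17:04Z); at `o = 0`, `m = 0`, `L = 3ℓ` it is the WDefs piece;
  bridge lemmas to the base-vertex convention (`φ tc = φ t + o`, p3-g13 15:17:56Z).
* `EquilibriumAtW2S G φ p t SEED M R ε n` — letter v1.3 (p3-g13's (a)(d)(f); p5-g13's σ4 drops the slanted clause, which has no base case in the slid regime
  and no reader): slide admissible, all FOUR side halves disjoint from the zone and linked (σ, τ = ±1) inside the tall region `pgramPrismO t o n h (3ℓs) R*`.
* `EquilibriumAtW.toW2S` — N1's symmetric equilibrium gives it with `o = 0`, `m = 0`, `ℓs = ℓ`.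
* `BothSidesLinked2S G φ types p` — the sentence `Eq.exists_equilibriumW2S` is to prove: `exists_equilibriumW`'s hypotheses MINUS the central inversion
  (`ρ`, `hρt`, `hρφ`, `hSρ`), `hQs` kept (it is (L2)'s input of the sliding split), conclusion `∃ n₁, ∀ n ≥ n₁, EquilibriumAtW2S … (ε + ε₀) n`.
[cite: MartineauTassion2017, §3.2 Lemma 3.5] [this work — stmt-g18 W1-SLIDING-SPLIT, p3-g13 N2-SCOPE v2]
-/

noncomputable section

namespace Summit.CriticalPhenomena.PercolationContinuityZ3.Theorems.Transplant

namespace Skelφ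

open MeasureTheory Literature.Probability.Percolation Literature.Probability.LatticeModels SimpleGraph KNLevels
open scoped Classical

variable {V : Type}

/-! ## §1 The offset twin of the parallelogram geometry (centre `φ t + o`) -/

/-- Coordinates relative to the slid centre `φ t + o`. [folklore] -/
def relCoordO (φ : V → Site 2) (t : V) (o : Site 2) (i : Fin 2) : V → ℤ := fun w => relCoord φ t i w - o i

/-- `relCoordO` unfolded. [folklore] -/
@[simp] theorem relCoordO_apply (φ : V → Site 2) (t : V) (o : Site 2) (i : Fin 2) (w : V) : relCoordO φ t o i w = relCoord φ t i w - o i := rfl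

/-- The sheared coordinate `β′ = n·β̃ − h·α̃` about the slid centre. [folklore] -/
def shearCoordO (φ : V → Site 2) (t : V) (o : Site 2) (n : ℕ) (h : ℤ) : V → ℤ := fun w => (n : ℤ) * relCoordO φ t o 1 w - h * relCoordO φ t o 0 w

/-- `shearCoordO` unfolded. [folklore] -/
@[simp] theorem shearCoordO_apply (φ : V → Site 2) (t : V) (o : Site 2) (n : ℕ) (h : ℤ) (w : V) :
    shearCoordO φ t o n h w = (n : ℤ) * (relCoord φ t 1 w - o 1) - h * (relCoord φ t 0 w - o 0) := rfl

/-- The slid parallelogram cylinder `{|α̃| ≤ n, |β′| ≤ n·ℓ}` about `φ t + o`. [this work] -/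
def pgramCylO (φ : V → Site 2) (t : V) (o : Site 2) (n : ℕ) (h : ℤ) (ℓ : ℕ) : Set V :=
  {w | |relCoordO φ t o 0 w| ≤ n ∧ |shearCoordO φ t o n h w| ≤ (n : ℤ) * ℓ}

/-- Membership in the slid parallelogram cylinder. [folklore] -/
@[simp] theorem mem_pgramCylO {φ : V → Site 2} {t : V} {o : Site 2} {n : ℕ} {h : ℤ} {ℓ : ℕ} {w : V} :
    w ∈ pgramCylO φ t o n h ℓ ↔ |relCoordO φ t o 0 w| ≤ n ∧ |shearCoordO φ t o n h w| ≤ (n : ℤ) * ℓ := Iff.rfl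

/-- The planar scale of the slid parallelogram: `pgScale n h ℓ + |o 0| + |o 1|` (a square about `φ t` containing it). [this work] -/
def pgScaleO (o : Site 2) (n : ℕ) (h : ℤ) (ℓ : ℕ) : ℕ := pgScale n h ℓ + (o 0).natAbs + (o 1).natAbs

variable (G : SimpleGraph V) (φ : V → Site 2)

/-- **The slid fat parallelogram** `cylBall t (pgScaleO o n h ℓ) R ∩ pgramCylO t o n h ℓ` (graph ball still about the base vertex `t`). [this work] -/
def pgramPrismO (t : V) (o : Site 2) (n : ℕ) (h : ℤ) (ℓ R : ℕ) : Set V := cylBall G φ t (pgScaleO o n h ℓ) R ∩ pgramCylO φ t o n h ℓ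

/-- Membership in the slid fat parallelogram. [folklore] -/
@[simp] theorem mem_pgramPrismO {t : V} {o : Site 2} {n : ℕ} {h : ℤ} {ℓ R : ℕ} {w : V} :
    w ∈ pgramPrismO G φ t o n h ℓ R ↔ w ∈ cylBall G φ t (pgScaleO o n h ℓ) R ∧ w ∈ pgramCylO φ t o n h ℓ := Iff.rfl

/-- The slid fat parallelogram is finite. [folklore] -/
theorem pgramPrismO_finite [G.LocallyFinite] (t : V) (o : Site 2) (n : ℕ) (h : ℤ) (ℓ R : ℕ) : (pgramPrismO G φ t o n h ℓ R).Finite :=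
  (cylBall_finite G φ t _ R).subset fun _ hw => hw.1

/-- The slid fat parallelogram as a `Finset`. [folklore] -/
def pgramPrismFinO [G.LocallyFinite] (t : V) (o : Site 2) (n : ℕ) (h : ℤ) (ℓ R : ℕ) : Finset V := (pgramPrismO_finite G φ t o n h ℓ R).toFinset

/-- Membership in `pgramPrismFinO`. [folklore] -/
@[simp] theorem mem_pgramPrismFinO [G.LocallyFinite] {t : V} {o : Site 2} {n : ℕ} {h : ℤ} {ℓ R : ℕ} {w : V} :
    w ∈ pgramPrismFinO G φ t o n h ℓ R ↔ w ∈ pgramPrismO G φ t o n h ℓ R := by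
  simp [pgramPrismFinO]

/-- **Side half of the slid box at height `ℓ`, inside the tall region of height `L`, split at the β′-offset `m`** (independent split points per side — the
parity point of p5-g13/p3-g13: the two drift points need not be congruent mod 2; `|m| ≤ n` = one chart unit of rounding):
`{w ∈ pgramPrismO t o n h L R ∩ C_o(n,h,ℓ) | α̃ = σn, 0 ≤ τ(β′ − m)}`. [cite: MartineauTassion2017, §3.2 (L(a,u), L(u,b) ⊂ R(a,b))] -/
def pgSideHalfS [G.LocallyFinite] (t : V) (o : Site 2) (n : ℕ) (h : ℤ) (L ℓ R : ℕ) (σ τ m : ℤ) : Finset V :=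
  (pgramPrismFinO G φ t o n h L R).filter fun w =>
    w ∈ pgramCylO φ t o n h ℓ ∧ relCoordO φ t o 0 w = σ * n ∧ 0 ≤ τ * (shearCoordO φ t o n h w - m)

/-- Membership in `pgSideHalfS`. [folklore] -/
theorem mem_pgSideHalfS [G.LocallyFinite] {t : V} {o : Site 2} {n : ℕ} {h : ℤ} {L ℓ R : ℕ} {σ τ m : ℤ} {w : V} :
    w ∈ pgSideHalfS G φ t o n h L ℓ R σ τ m ↔ w ∈ pgramPrismO G φ t o n h L R ∧ w ∈ pgramCylO φ t o n h ℓ ∧ relCoordO φ t o 0 w = σ * n ∧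
      0 ≤ τ * (shearCoordO φ t o n h w - m) := by
  simp only [pgSideHalfS, Finset.mem_filter, mem_pgramPrismFinO]

/-- The side halves lie in the tall region. [folklore] -/
theorem coe_pgSideHalfS_subset [G.LocallyFinite] (t : V) (o : Site 2) (n : ℕ) (h : ℤ) (L ℓ R : ℕ) (σ τ m : ℤ) :
    (↑(pgSideHalfS G φ t o n h L ℓ R σ τ m) : Set V) ⊆ pgramPrismO G φ t o n h L R := fun _ hw => ((mem_pgSideHalfS G φ).1 hw).1

/-! ## §2 At offset `0` the twin is the WDefs geometry -/

/-- `pgScaleO 0 = pgScale`. [folklore] -/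
@[simp] theorem pgScaleO_zero (n : ℕ) (h : ℤ) (ℓ : ℕ) : pgScaleO 0 n h ℓ = pgScale n h ℓ := by simp [pgScaleO]

/-- `pgramCylO` at offset `0` is `pgramCyl`. [folklore] -/
@[simp] theorem pgramCylO_zero (t : V) (n : ℕ) (h : ℤ) (ℓ : ℕ) : pgramCylO φ t 0 n h ℓ = pgramCyl φ t n h ℓ := by
  ext w; simp [pgramCylO, pgramCyl, shearCoordO, shearCoord, relCoordO, relCoord]

/-- `shearCoordO` at offset `0` is `shearCoord`. [folklore] -/
@[simp] theorem shearCoordO_zero (t : V) (n : ℕ) (h : ℤ) (w : V) : shearCoordO φ t 0 n h w = shearCoord φ t n h w := by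
  simp [shearCoordO, shearCoord, relCoordO, relCoord]

/-- `pgramPrismO` at offset `0` is `pgramPrism`. [folklore] -/
@[simp] theorem pgramPrismO_zero (t : V) (n : ℕ) (h : ℤ) (ℓ R : ℕ) : pgramPrismO G φ t 0 n h ℓ R = pgramPrism G φ t n h ℓ R := by
  ext w; simp [pgramPrismO, pgramPrism]

/-- `pgSideHalfS` at offset `0`, split offset `0`, region height `3ℓ`, is `pgSideHalfW`. [folklore] -/
theorem pgSideHalfS_zero [G.LocallyFinite] (t : V) (n : ℕ) (h : ℤ) (ℓ R : ℕ) (σ τ : ℤ) :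
    pgSideHalfS G φ t 0 n h (3 * ℓ) ℓ R σ τ 0 = pgSideHalfW G φ t n h ℓ R σ τ := by
  ext w; simp only [mem_pgSideHalfS, mem_pgSideHalfW, pgramPrismO_zero, pgramCylO_zero, shearCoordO_zero, relCoordO_apply, Pi.zero_apply, sub_zero]

/-! ## §2b Bridge to p3-g13's base-vertex convention: at a vertex `tc` with `φ tc = φ t + o` the slid cylinder objects ARE N1's objects at base `tc`
(the fat part stays about `t`, the base of the consumers' radius data) -/

/-- `relCoordO t o = relCoord tc` when `φ tc = φ t + o`. [folklore] -/
theorem relCoordO_eq_of_base {φ : V → Site 2} {t tc : V} {o : Site 2} (htc : φ tc = φ t + o) (i : Fin 2) (w : V) :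
    relCoordO φ t o i w = relCoord φ tc i w := by
  simp only [relCoordO_apply, relCoord, htc, Pi.add_apply]; ring

/-- `shearCoordO t o = shearCoord tc` when `φ tc = φ t + o`. [folklore] -/
theorem shearCoordO_eq_of_base {φ : V → Site 2} {t tc : V} {o : Site 2} (htc : φ tc = φ t + o) (n : ℕ) (h : ℤ) (w : V) :
    shearCoordO φ t o n h w = shearCoord φ tc n h w := by
  simp only [shearCoordO, shearCoord_apply, relCoordO_eq_of_base htc, relCoord]

/-- `pgramCylO t o = pgramCyl tc` when `φ tc = φ t + o`. [folklore] -/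
theorem pgramCylO_eq_of_base {φ : V → Site 2} {t tc : V} {o : Site 2} (htc : φ tc = φ t + o) (n : ℕ) (h : ℤ) (ℓ : ℕ) :
    pgramCylO φ t o n h ℓ = pgramCyl φ tc n h ℓ := by
  ext w; simp only [mem_pgramCylO, mem_pgramCyl, relCoordO_eq_of_base htc, shearCoordO_eq_of_base htc]

/-! ## §3 The statement shape of record -/

/-- **Both vertical sides linked, slid box** (the letter of record v1.3: p3-g13 15:10:58Z (a)(d)(f), parity fix (i) of p5-g13/p3-g13, p5-g13's σ4 dropping the
slanted clause) at width `n`: a centre offset `o = (s, b)`, a shear `h`, a side height `ℓs`, split offsets `m σ` with `|m σ| ≤ n`; (a) slide admissible `M + |s| < n`; (d) the FOUR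
side halves `pgSideHalfS t o n h (3ℓs) ℓs R* σ τ (m σ)` (`σ, τ = ±1`) are disjoint from the zone `cyl t M` and linked from `SEED` with probability `≥ 1 − ε` inside the tall region
`pgramPrismO t o n h (3ℓs) R*`; (f) everything read at the radius `R* = R (pgScaleO o n h (3ℓs))` of the caller's radius data.  No slanted clause: the routes read the slanted
family CENTRED (`exists_equilibriumWQ`), the kit reads only side halves. [cite: MartineauTassion2017, §3.2 Lemma 3.5] [this work] -/
def EquilibriumAtW2S [G.LocallyFinite] (p : unitInterval) (t : V) (SEED : Finset V) (M : ℕ) (R : ℕ → ℕ) (ε : ℝ) (n : ℕ) : Prop :=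
  ∃ (o : Site 2) (h : ℤ) (ℓs : ℕ) (m : ℤ → ℤ), M + (o 0).natAbs < n ∧ (∀ σ : ℤ, |m σ| ≤ n) ∧
    ∀ σ τ : ℤ, (σ = 1 ∨ σ = -1) → (τ = 1 ∨ τ = -1) →
      Disjoint (↑(pgSideHalfS G φ t o n h (3 * ℓs) ℓs (R (pgScaleO o n h (3 * ℓs))) σ τ (m σ)) : Set V) (cyl φ t M) ∧
      1 - ε ≤ (bondPercolation G p).real
        (linkIn (pgramPrismO G φ t o n h (3 * ℓs) (R (pgScaleO o n h (3 * ℓs)))) SEED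
          (pgSideHalfS G φ t o n h (3 * ℓs) ℓs (R (pgScaleO o n h (3 * ℓs))) σ τ (m σ)))

variable {G φ}

/-- **N1 compatibility**: the symmetric equilibrium `EquilibriumAtW` (all eight links) gives `EquilibriumAtW2S` with offset `0`, split offsets `0`, `ℓs = ℓ`. [folklore] -/
theorem EquilibriumAtW.toW2S [G.LocallyFinite] {p : unitInterval} {t : V} {SEED : Finset V} {M : ℕ} {R : ℕ → ℕ} {ε : ℝ} {n : ℕ}
    (hE : EquilibriumAtW G φ p t SEED M R ε n) : EquilibriumAtW2S G φ p t SEED M R ε n := by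
  obtain ⟨h, ℓ, v, hMn, -, -, -, hall⟩ := hE
  refine ⟨0, h, ℓ, fun _ => 0, by simpa using hMn, fun _ => by simp, fun σ τ hσ hτ => ?_⟩
  obtain ⟨h1, -, h3, -⟩ := hall σ τ hσ hτ
  simp only [pgScaleO_zero, pgSideHalfS_zero, pgramPrismO_zero]
  exact ⟨h1, h3⟩

variable (G φ)

/-- **(W1) BOTH SIDES LINKED, slid form — the sentence `Eq.exists_equilibriumW2S` is to prove** (OPEN; a `Prop`, never asserted): the hypotheses of
`Eq.exists_equilibriumW` MINUS the central inversion (`ρ`, `hρt`, `hρφ`, `hSρ`), with the accuracy binder `2ε ≤ 1` (p3-g14: the sliding split's constants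
`√(2√(2δ))` need `ε ≤ 0.92`; callers pass `ε/2`) — base vertex `t ∈ types`, zone `M ≥ 1`, seed `SEED ∋ t` inside `cyl t M` percolating w.p. `≥ 1 − ε³²`, strips and half-lines left a.s. (`hQs`, `hQx` — (L2)'s input), radius data `R` with tails `≤ ε₀` — give, for all large widths `n`,
an `EquilibriumAtW2S` at accuracy `ε + ε₀`. (The carrier hypotheses `Lip`/`Steps`/`Frames`/`CylSubcritical`/`0 < p < 1` are supplied by the caller of the theorem.)
[cite: MartineauTassion2017, §3.2 Lemma 3.5] [this work] -/
def BothSidesLinked2S [G.LocallyFinite] (types : Finset V) (p : unitInterval) : Prop :=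
  ∀ t ∈ types, ∀ (M : ℕ), 1 ≤ M → ∀ (SEED : Finset V), t ∈ SEED → (↑SEED : Set V) ⊆ cyl φ t M →
    (∀ n, Eq.MeetsAS G p (Eq.strip φ t n)ᶜ) → (∀ σu : ℤˣ, Eq.MeetsAS G p (Eq.Xinf φ t (σu : ℤ) (M + 3))ᶜ) →
    ∀ (ε ε₀ : ℝ), 0 < ε → 2 * ε ≤ 1 → 1 - ε ^ 32 ≤ (bondPercolation G p).real (TwoAxis.SeedPerc (↑SEED : Set V)) →
    ∀ (R : ℕ → ℕ), (∀ L, M ≤ L → 1 ≤ R L) → (∀ L, M ≤ L → (↑SEED : Set V) ⊆ cylBall G φ t L (R L)) →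
      (∀ L, M ≤ L → (bondPercolation G p).real (⋃ b ∈ SEED, cylReach G φ t L (R L - 1) b) ≤ ε₀) →
      ∃ n₁, ∀ n, n₁ ≤ n → EquilibriumAtW2S G φ p t SEED M R (ε + ε₀) n

end Skelφ

end Summit.CriticalPhenomena.PercolationContinuityZ3.Theorems.Transplant

end
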